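import Summits.QuantumAdvantage.QuantumAdvantage.Theorems.NearExactIsExact.Negative.TypeOTwelve
import HarnessLib

/-!
# No case A on 12 bits: cubic isolation at `15/16` (NearExactIsExact, disprover's structure file, part 3)

Negative-side STRUCTURE for the crux `CubicForrelation.NearExactIsExact` (item `near_exact_is_exact`) at `n = 12`,
from the B2b disprover seat. HONEST FRAMING: a THEOREM about the finite slice `n = 12`, NOT summit progress.
It closes "case A" of `Negative/TypeOTwelve.lean` and thereby sharpens the certified isolation constant for cubic
pairs on 12 bits to `15/16` (`isolation_twelve_15_16`; the tree had `31/32`, part 2 had `1963/2048`): for cubic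
`f, g : 𝔽₂¹² → 𝔽₂`, `Φ(f,g) > 15/16 ⇒ Φ(f,g) = 1`. With the landed pair at `57/64` (`Negative/F8ChainTwelve.lean`) the
largest non-exact cubic forrelation value on 12 bits lies in `[57/64, 15/16]`.

## The argument (monomial expansion one power of two beyond Ax)

For a polynomial phase `(−1)^{p(x)}`, `p` of degree `≤ 3` on 12 variables, and a coordinate cube
`E_K = {x : supp x ⊆ K}` with `|K| = 3m`, expanding `∏_s (1 − 2·[s(x) = 1])` over sets `S` of monomials
(`cube_bias_expand`) and reducing modulo `2^{m+1}` (`cube_bias_congr`): only the SATURATED families — `m` pairwise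
disjoint cubic monomials tiling `K` — survive, so `Σ_{E_K} (−1)^p ≡ (−2)^m · N_m(K) (mod 2^{m+1})`.
* `K = univ`, `m = 4`: type O (`u(0…0) = Σ_{E_univ}(−1)^g / 16` odd) forces `N₄` odd.
* `N₄ = Σ_{s₀ ∋ 0} N₃((supp s₀)ᶜ)` (`card_saturated_four`: the tiling member containing the variable `0`), so some
  cubic monomial `s₀` has `T := supp s₀`, `|T| = 3`, with `N₃(Tᶜ)` odd; then Poisson (`bb_poisson`) over `E_T`
  and the congruence on `E_{Tᶜ}` (`m = 3`) give `Σ_{x ∈ E_T} u(x) ≡ 4 (mod 8)`.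
* In case A every `u ≡ ±3 (mod 8)`, i.e. `u ≡ 3 + 4τ (mod 8)` with the AFFINE digit `τ` of part 1 (`digit_two`);
  an affine function takes the value `1` an even number of times on a 3-cube (`0, 4` or `8`), so
  `Σ_{E_T} u ≡ 8·3/… ≡ 0 (mod 8)` — contradiction (`no_caseA`).
Hence `e ≥ 512` always, `Σ|W_g| ≤ 2^{18}·15/16` for every type-O cubic (`typeO_capacity_15_16`), and the tower of
`CubicForrelationNearExactIsExactIsolationSmallN` yields `isolation_twelve_15_16`, `no_window_twelve_15_16`,
`nearExact_slice_twelve_15_16`.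

Tightness remarks (numerics of this seat, not used in the proofs): level 6 of the tower does attain capacity
exactly `15/16` (an `r = 3` almost-Maiorana–McFarland cubic with spectrum `{0:384, ±64:3584, ±128:128}`), so
one-sided capacity arguments cannot go below `15/16` at `n = 12`; the best type-O capacity met is `≈ 0.883`.

Sources: J. Ax (1964) / R. McEliece (1972) (Carlet 2021 §4.1); MacWilliams–Sloane Ch. 13–15; O'Donnell (2014)
§1.4. Axioms: the standard three.
-/

set_option linter.dupNamespace false -- D-0017: single-problem summit ⇒ `QuantumAdvantage.QuantumAdvantage` by design

noncomputable section

namespace Summit.QuantumAdvantage.QuantumAdvantage.Theorems.NearExactIsExact.Negative.TypeOTwelve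

open Finset
open Literature.Computability.QuantumComplexity
open Literature.Computability.QuantumComplexity.DerivativeWalsh (W fsum fsum_eq_sum_mul_W fsum_eq_sum_mul_W' sum_W_sq)
open Summit.QuantumAdvantage.QuantumAdvantage.Theorems.CubicForrelation.NearExactIsExact
open Summit.QuantumAdvantage.QuantumAdvantage.Theorems.SignedCubicForrelationNotPrBPP (knf_isDegLeFun_ip)
open Summit.QuantumAdvantage.QuantumAdvantage.Theorems.SignedCubicForrelationNotPrBPP.Negative.HalfQuad (forrelation_comm)

/-! ### The monomial expansion modulo the next power of two -/

section Expansion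

variable (p : MvPolynomial (Fin (6 + 6)) (ZMod 2))

/-- The expansion of the integer bias sum of a polynomial phase over a coordinate cube `E_K`:
`Σ_{x ∈ E_K} Π_s (−1)^{[supp s ⊆ supp x]} = Σ_{S ⊆ Mon(p)} [U_S ⊆ K] · (−2)^{|S|} · 2^{|K| − |U_S|}`, `U_S = ⋃_{s∈S} supp s`
(`ax_prod_sign_eq`, `ax_prod_indicator`, `ax_card_cube_sup`). [folklore; McEliece 1972 / Carlet 2021 §4.1] -/
theorem cube_bias_expand (K : Finset (Fin (6 + 6))) :
    ∑ x ∈ {x : Fin (6 + 6) → Bool | ∀ i, x i = true → i ∈ K},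
        ∏ s ∈ p.support, (if (∀ j ∈ s.support, x j = true) then (-1 : ℤ) else 1) =
      ∑ S ∈ p.support.powerset,
        (if (S.biUnion fun s => s.support) ⊆ K then
          (-2 : ℤ) ^ #S * 2 ^ (#K - #(S.biUnion fun s => s.support)) else 0) := by
  simp_rw [ax_prod_sign_eq]
  rw [sum_comm]
  refine sum_congr rfl fun S _ => ?_
  simp_rw [ax_prod_indicator]
  rw [← sum_filter, sum_const, filter_filter, nsmul_eq_mul]
  by_cases hU : (S.biUnion fun s => s.support) ⊆ K
  · rw [ax_card_cube_sup hU, if_pos hU]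
    push_cast
    ring
  · rw [ax_card_cube_sup_eq_zero hU, if_neg hU]
    simp

/-- **Saturated terms.** For `p` of total degree `≤ 3` and `|K| = 3m`, modulo `2^{m+1}` only the sets of `m`
monomials whose supports tile `K` survive:
`Σ_{x ∈ E_K} Π_s (−1)^{[supp s ⊆ supp x]} = (−2)^m · #{S ⊆ Mon(p) : |S| = m, U_S = K} + 2^{m+1} k`
(a term with `|S| = a` and `U_S ⊆ K` has `|U_S| ≤ min(3a, 3m)`, so its exponent `a + 3m − |U_S|` is `≥ m + 1` unless
`a = m` and `U_S = K`). With `m = 4, K = univ` this is `bias(g) ≡ 16·#{perfect matchings of the 12 variables by 4 cubic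
monomials} (mod 32)`; with `m = 3` it is the same fact for the restriction to a `9`-dimensional coordinate cube. -/
theorem cube_bias_congr (hp : p.totalDegree ≤ 3) (K : Finset (Fin (6 + 6))) (m : ℕ) (hK : #K = 3 * m) :
    ∃ k : ℤ, ∑ x ∈ {x : Fin (6 + 6) → Bool | ∀ i, x i = true → i ∈ K},
        ∏ s ∈ p.support, (if (∀ j ∈ s.support, x j = true) then (-1 : ℤ) else 1) =
      (-2 : ℤ) ^ m * (#{S ∈ p.support.powerset | #S = m ∧ (S.biUnion fun s => s.support) = K} : ℕ) +
        2 ^ (m + 1) * k := by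
  have h1 : ∀ S ∈ {S ∈ p.support.powerset | #S = m ∧ (S.biUnion fun s => s.support) = K},
      (if (S.biUnion fun s => s.support) ⊆ K then
        (-2 : ℤ) ^ #S * 2 ^ (#K - #(S.biUnion fun s => s.support)) else 0) = (-2 : ℤ) ^ m := by
    intro S hS
    obtain ⟨-, hSm, hSU⟩ := mem_filter.1 hS
    rw [hSU, if_pos (Subset.refl K), hSm, Nat.sub_self, pow_zero, mul_one]
  have h2 : ∀ S ∈ {S ∈ p.support.powerset | ¬ (#S = m ∧ (S.biUnion fun s => s.support) = K)},
      (2 : ℤ) ^ (m + 1) ∣ (if (S.biUnion fun s => s.support) ⊆ K then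
        (-2 : ℤ) ^ #S * 2 ^ (#K - #(S.biUnion fun s => s.support)) else 0) := by
    intro S hS
    obtain ⟨hSp, hnot⟩ := mem_filter.1 hS
    split_ifs with hU
    · have hUS : #(S.biUnion fun s => s.support) ≤ 3 * #S := ax_card_biUnion_le hp (mem_powerset.1 hSp)
      have hUK : #(S.biUnion fun s => s.support) ≤ #K := card_le_card hU
      have hne : ¬ (#S = m ∧ #(S.biUnion fun s => s.support) = #K) := by
        rintro ⟨hSm, hc⟩
        exact hnot ⟨hSm, eq_of_subset_of_card_le hU hc.ge⟩
      have hexp : m + 1 ≤ #S + (#K - #(S.biUnion fun s => s.support)) := by omega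
      rw [neg_pow, mul_assoc, ← pow_add]
      exact Dvd.dvd.mul_left (pow_dvd_pow 2 hexp) _
    · exact dvd_zero _
  obtain ⟨k, hk⟩ := dvd_sum h2
  refine ⟨k, ?_⟩
  rw [cube_bias_expand p K, ← sum_filter_add_sum_filter_not p.support.powerset
    (fun S => #S = m ∧ (S.biUnion fun s => s.support) = K), sum_congr rfl h1, sum_const, nsmul_eq_mul, hk]
  ring

/-- **The monomial through a fixed variable.** The sets of `4` monomials of a cubic whose supports cover all `12`
variables are the disjoint union, over the monomials `s₀` involving the variable `0`, of `insert s₀` applied to the sets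
of `3` monomials whose supports cover exactly `(supp s₀)ᶜ` (the supports in a covering `4`-set are forced to be
pairwise disjoint triples by counting). This is the identity `pm(V) = Σ_{e ∋ v} pm(V ∖ e)` for perfect matchings of a
`3`-uniform hypergraph. [folklore] -/
theorem saturated_four_eq_biUnion (hp : p.totalDegree ≤ 3) :
    {S ∈ p.support.powerset | #S = 4 ∧ (S.biUnion fun s => s.support) = univ} =
      (p.support.filter fun s₀ => (0 : Fin (6 + 6)) ∈ s₀.support).biUnion fun s₀ =>
        ({S' ∈ p.support.powerset | #S' = 3 ∧ (S'.biUnion fun s => s.support) = s₀.supportᶜ}).image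
          (insert s₀) := by
  ext S
  constructor
  · intro hS
    obtain ⟨hSp', hS4, hSU⟩ := mem_filter.1 hS
    have hSp : S ⊆ p.support := mem_powerset.1 hSp'
    have h0 : (0 : Fin (6 + 6)) ∈ S.biUnion fun s => s.support := by rw [hSU]; exact mem_univ _
    obtain ⟨s₀, hs₀S, h0s₀⟩ := mem_biUnion.1 h0
    refine mem_biUnion.2 ⟨s₀, mem_filter.2 ⟨hSp hs₀S, h0s₀⟩, mem_image.2 ⟨S.erase s₀, ?_, insert_erase hs₀S⟩⟩
    refine mem_filter.2 ⟨mem_powerset.2 ((erase_subset _ _).trans hSp), ?_, ?_⟩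
    · rw [card_erase_of_mem hs₀S, hS4]
    · symm
      apply eq_of_subset_of_card_le
      · intro i hi
        rw [mem_compl] at hi
        have hiU : i ∈ S.biUnion fun s => s.support := by rw [hSU]; exact mem_univ _
        obtain ⟨s, hsS, his⟩ := mem_biUnion.1 hiU
        have hss₀ : s ≠ s₀ := by
          rintro rfl
          exact hi his
        exact mem_biUnion.2 ⟨s, mem_erase.2 ⟨hss₀, hsS⟩, his⟩
      · have h9 : #((S.erase s₀).biUnion fun s => s.support) ≤ 3 * #(S.erase s₀) :=
          ax_card_biUnion_le hp ((erase_subset _ _).trans hSp)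
        have h3 : #s₀.support ≤ 3 := ax_card_support_le hp (hSp hs₀S)
        rw [card_erase_of_mem hs₀S, hS4] at h9
        rw [card_compl, Fintype.card_fin]
        omega
  · intro hS
    obtain ⟨s₀, hs₀F, hSim⟩ := mem_biUnion.1 hS
    obtain ⟨hs₀p, h0s₀⟩ := mem_filter.1 hs₀F
    obtain ⟨S', hS'B, rfl⟩ := mem_image.1 hSim
    obtain ⟨hS'p', hS'3, hS'U⟩ := mem_filter.1 hS'B
    have hS'p : S' ⊆ p.support := mem_powerset.1 hS'p'
    have hs₀S' : s₀ ∉ S' := by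
      intro h
      have h0 : (0 : Fin (6 + 6)) ∈ S'.biUnion fun s => s.support := mem_biUnion.2 ⟨s₀, h, h0s₀⟩
      rw [hS'U, mem_compl] at h0
      exact h0 h0s₀
    refine mem_filter.2 ⟨mem_powerset.2 (insert_subset hs₀p hS'p), ?_, ?_⟩
    · rw [card_insert_of_notMem hs₀S', hS'3]
    · rw [biUnion_insert, hS'U, union_compl]

/-- Counting version of `saturated_four_eq_biUnion`: `N₄ = Σ_{s₀ ∋ 0} N₃((supp s₀)ᶜ)`. [folklore] -/
theorem card_saturated_four (hp : p.totalDegree ≤ 3) :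
    #{S ∈ p.support.powerset | #S = 4 ∧ (S.biUnion fun s => s.support) = univ} =
      ∑ s₀ ∈ p.support.filter (fun s₀ => (0 : Fin (6 + 6)) ∈ s₀.support),
        #{S' ∈ p.support.powerset | #S' = 3 ∧ (S'.biUnion fun s => s.support) = s₀.supportᶜ} := by
  -- no saturated `3`-set of `(supp s₀)ᶜ` contains `s₀`
  have key : ∀ s₀ ∈ p.support.filter (fun s₀ => (0 : Fin (6 + 6)) ∈ s₀.support),
      ∀ S' ∈ {S' ∈ p.support.powerset | #S' = 3 ∧ (S'.biUnion fun s => s.support) = s₀.supportᶜ},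
        ∀ s ∈ S', (0 : Fin (6 + 6)) ∉ s.support := by
    intro s₀ hs₀ S' hS' s hs h0
    have h0U : (0 : Fin (6 + 6)) ∈ S'.biUnion fun s => s.support := mem_biUnion.2 ⟨s, hs, h0⟩
    rw [(mem_filter.1 hS').2.2, mem_compl] at h0U
    exact h0U (mem_filter.1 hs₀).2
  have hdisj : ((p.support.filter fun s₀ => (0 : Fin (6 + 6)) ∈ s₀.support : Finset _) : Set _).PairwiseDisjoint
      fun s₀ => ({S' ∈ p.support.powerset | #S' = 3 ∧ (S'.biUnion fun s => s.support) = s₀.supportᶜ}).image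
        (insert s₀) := by
    intro s₀ hs₀ s₁ hs₁ hne
    rw [Function.onFun, disjoint_left]
    intro S hS hS1
    obtain ⟨S', hS', rfl⟩ := mem_image.1 hS
    obtain ⟨S'', hS'', hEq⟩ := mem_image.1 hS1
    have hs₁S : s₁ ∈ insert s₀ S' := by
      rw [← hEq]
      exact mem_insert_self _ _
    rcases mem_insert.1 hs₁S with h | h
    · exact hne h.symm
    · exact key s₀ (mem_coe.1 hs₀) S' hS' s₁ h (mem_filter.1 (mem_coe.1 hs₁)).2
  rw [saturated_four_eq_biUnion p hp, card_biUnion hdisj]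
  refine sum_congr rfl fun s₀ hs₀ => card_image_of_injOn fun S' hS' S'' hS'' h => ?_
  have h1 : s₀ ∉ S' := fun hm => key s₀ hs₀ S' (mem_coe.1 hS') s₀ hm (mem_filter.1 hs₀).2
  have h2 : s₀ ∉ S'' := fun hm => key s₀ hs₀ S'' (mem_coe.1 hS'') s₀ hm (mem_filter.1 hs₀).2
  rw [← erase_insert h1, h, erase_insert h2]

end Expansion

/-! ### No case A -/

section NoCaseA

variable (g : (Fin (6 + 6) → Bool) → Bool) (u : (Fin (6 + 6) → Bool) → ℤ)

/-- **Case A is empty.** No cubic `g : 𝔽₂¹² → 𝔽₂` has every `W_g(x)/16 ≡ ±3 (mod 8)`.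
Proof: (1) `u` is odd at the point of `E_∅`, so by `cube_bias_congr` (`m = 4`) the number `N₄` of sets of `4` monomials
tiling the `12` variables is odd; (2) by `card_saturated_four` some monomial `s₀ ∋ 0` (support `T`, `|T| = 3`) has an
odd number of `3`-sets tiling `Tᶜ`, so by `cube_bias_congr` (`m = 3`) and Poisson summation `Σ_{x ∈ E_T} u(x) ≡ 4
(mod 8)`; (3) but `u ≡ 5 − 2t (mod 8)` with `t = [u₁ odd]` the AFFINE second digit (`digit_two`), and an affine function
has weight `≡ 0 (mod 4)` on the `3`-cube `E_T` (Ax with `d = 1`), so `Σ_{E_T} u ≡ 40 − 2·(4ℤ) ≡ 0 (mod 8)`. -/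
theorem no_caseA (hg : IsDegLeFun 3 g) (hu : ∀ x, W (fun y => signOf (g y)) x = (2 : ℝ) ^ 4 * (u x : ℝ))
    (h35 : ∀ x, u x % 8 = 3 ∨ u x % 8 = 5) : False := by
  obtain ⟨p, hp, hrep⟩ := id hg
  -- the integer bias sums over coordinate cubes
  have hbias : ∀ K : Finset (Fin (6 + 6)),
      ∑ x ∈ {x : Fin (6 + 6) → Bool | ∀ i, x i = true → i ∈ K}, signOf (g x) =
        ((∑ x ∈ {x : Fin (6 + 6) → Bool | ∀ i, x i = true → i ∈ K},
          ∏ s ∈ p.support, (if (∀ j ∈ s.support, x j = true) then (-1 : ℤ) else 1) : ℤ) : ℝ) := by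
    intro K
    rw [Int.cast_sum]
    exact sum_congr rfl fun x _ => by rw [hrep x, ax_signOf_polyPhase]
  -- Poisson summation: `16 Σ_{E_I} u = 2^{|I|} Σ_{E_{Iᶜ}} (−1)^g`
  have hpois : ∀ I : Finset (Fin (6 + 6)),
      (2 : ℝ) ^ 4 * ∑ x ∈ {x : Fin (6 + 6) → Bool | ∀ i, x i = true → i ∈ I}, (u x : ℝ) =
        (2 : ℝ) ^ #I * ∑ y ∈ {x : Fin (6 + 6) → Bool | ∀ i, x i = true → i ∈ Iᶜ}, signOf (g y) := by
    intro I
    have hP := bb_poisson (fun y => signOf (g y)) I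
    rw [sum_congr rfl fun x _ => hu x, ← mul_sum] at hP
    exact hP
  -- (1) `N₄` is odd
  obtain ⟨k₄, hk₄⟩ := cube_bias_congr p hp univ 4 (by rw [card_univ, Fintype.card_fin])
  have hE0 : #({x : Fin (6 + 6) → Bool | ∀ i, x i = true → i ∈ (∅ : Finset (Fin (6 + 6)))} : Finset _) = 1 := by
    rw [bb_card_cube, card_empty, pow_zero]
  obtain ⟨a, ha⟩ := card_eq_one.1 hE0
  have h0 := hpois ∅
  rw [ha, sum_singleton, card_empty, pow_zero, one_mul, compl_empty, hbias univ, hk₄] at h0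
  have h0z : (2 : ℤ) ^ 4 * u a = (-2) ^ 4 *
      (#{S ∈ p.support.powerset | #S = 4 ∧ (S.biUnion fun s => s.support) = univ} : ℕ) + 2 ^ (4 + 1) * k₄ := by
    exact_mod_cast h0
  have hN₄ : ¬ Even #{S ∈ p.support.powerset | #S = 4 ∧ (S.biUnion fun s => s.support) = univ} := by
    rintro ⟨r, hr⟩
    have hua := h35 a
    rw [hr] at h0z
    push_cast at h0z
    omega
  -- (2) some monomial `s₀ ∋ 0` has an odd number of `3`-sets tiling the complement of its support `T`
  rw [card_saturated_four p hp] at hN₄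
  have hex : ∃ s₀ : Fin (6 + 6) →₀ ℕ,
      s₀ ∈ p.support.filter (fun s => (0 : Fin (6 + 6)) ∈ s.support) ∧
      ¬ Even #{S' ∈ p.support.powerset | #S' = 3 ∧ (S'.biUnion fun s => s.support) = s₀.supportᶜ} := by
    by_contra hall
    push Not at hall
    exact hN₄ (Finset.even_sum _ hall)
  obtain ⟨s₀, hs₀F, hs₀odd⟩ := hex
  set T := s₀.support with hT
  have hT3 : #T = 3 := by
    have hle : #T ≤ 3 := ax_card_support_le hp (mem_filter.1 hs₀F).1
    have hne : ({S' ∈ p.support.powerset | #S' = 3 ∧ (S'.biUnion fun s => s.support) = Tᶜ} : Finset _).Nonempty := by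
      rw [nonempty_iff_ne_empty]
      intro h
      rw [h, card_empty] at hs₀odd
      exact hs₀odd ⟨0, rfl⟩
    obtain ⟨S', hS'⟩ := hne
    obtain ⟨hS'p, hS'3, hS'U⟩ := mem_filter.1 hS'
    have h9 : #(S'.biUnion fun s => s.support) ≤ 3 * #S' := ax_card_biUnion_le hp (mem_powerset.1 hS'p)
    rw [hS'U, hS'3, card_compl, Fintype.card_fin] at h9
    omega
  obtain ⟨k₃, hk₃⟩ := cube_bias_congr p hp Tᶜ 3 (by rw [card_compl, Fintype.card_fin, hT3])
  have h1 := hpois T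
  rw [hT3, hbias Tᶜ, hk₃] at h1
  have h1z : (2 : ℤ) ^ 4 * ∑ x ∈ {x : Fin (6 + 6) → Bool | ∀ i, x i = true → i ∈ T}, u x =
      2 ^ 3 * ((-2) ^ 3 *
        (#{S' ∈ p.support.powerset | #S' = 3 ∧ (S'.biUnion fun s => s.support) = Tᶜ} : ℕ) + 2 ^ (3 + 1) * k₃) := by
    exact_mod_cast h1
  obtain ⟨j, hj⟩ := Nat.not_even_iff_odd.1 hs₀odd
  rw [hj] at h1z
  push_cast at h1z
  -- (3) the affine second digit on the cube `E_T`
  obtain ⟨u₁, hu₁⟩ : ∃ u₁ : (Fin (6 + 6) → Bool) → ℤ, ∀ x, u₁ x = u x / 2 := ⟨_, fun _ => rfl⟩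
  have h1' : ∀ x, u x = 2 * u₁ x + 1 := by
    intro x
    have := h35 x
    rw [hu₁ x]
    omega
  have hτ := digit_two g u hg hu u₁ h1'
  obtain ⟨z, hz⟩ := stub_axParity (6 + 6) 1 (fun x => decide (Odd (u₁ x))) T le_rfl hτ
  have hexp : (#T + 1 - 1) / 1 = 3 := by rw [hT3]
  rw [hexp] at hz
  obtain ⟨t, ht⟩ : ∃ t : (Fin (6 + 6) → Bool) → ℤ, ∀ x, t x = if Odd (u₁ x) then 1 else 0 := ⟨_, fun _ => rfl⟩
  have hsign : ∀ x, signOf (decide (Odd (u₁ x))) = 1 - 2 * (t x : ℝ) := fun x => by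
    rw [ht x]
    by_cases h : Odd (u₁ x)
    · simp [h, signOf]; norm_num
    · simp [h, signOf]
  rw [sum_congr rfl fun x _ => hsign x, sum_sub_distrib, sum_const, nsmul_eq_mul, mul_one, ← mul_sum] at hz
  have hcardR : ((#({x : Fin (6 + 6) → Bool | ∀ i, x i = true → i ∈ T} : Finset _) : ℕ) : ℝ) = (2 : ℝ) ^ 3 := by
    rw [bb_card_cube T, hT3]
    norm_num
  rw [hcardR] at hz
  have hTz : (2 : ℤ) ^ 3 - 2 * ∑ x ∈ {x : Fin (6 + 6) → Bool | ∀ i, x i = true → i ∈ T}, t x = 2 ^ 3 * z := by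
    exact_mod_cast hz
  -- pointwise `u = 8q + 5 − 2t`
  have hpt : ∀ x, u x = 8 * (u x / 8) + 5 - 2 * t x := by
    intro x
    have h8 := h35 x
    rw [ht x]
    by_cases ho : Odd (u₁ x)
    · rw [if_pos ho]
      have h2 := Int.odd_iff.1 ho
      rw [hu₁ x] at h2
      omega
    · rw [if_neg ho]
      have h2 := Int.even_iff.1 (Int.not_odd_iff_even.1 ho)
      rw [hu₁ x] at h2
      omega
  have hsumT : ∑ x ∈ {x : Fin (6 + 6) → Bool | ∀ i, x i = true → i ∈ T}, u x =
      8 * ∑ x ∈ {x : Fin (6 + 6) → Bool | ∀ i, x i = true → i ∈ T}, (u x / 8) + 2 ^ #T * 5 -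
        2 * ∑ x ∈ {x : Fin (6 + 6) → Bool | ∀ i, x i = true → i ∈ T}, t x := by
    rw [sum_congr rfl fun x _ => hpt x, sum_sub_distrib, sum_add_distrib, ← mul_sum, ← mul_sum, sum_const,
      nsmul_eq_mul, card_cube_int]
  rw [hT3] at hsumT
  have e1 : ∑ x ∈ {x : Fin (6 + 6) → Bool | ∀ i, x i = true → i ∈ T}, u x = -8 * (j : ℤ) - 4 + 8 * k₃ := by
    linarith [h1z]
  have e2 : ∑ x ∈ {x : Fin (6 + 6) → Bool | ∀ i, x i = true → i ∈ T}, t x = 4 - 4 * z := by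
    linarith [hTz]
  have e3 : ∑ x ∈ {x : Fin (6 + 6) → Bool | ∀ i, x i = true → i ∈ T}, u x =
      8 * ∑ x ∈ {x : Fin (6 + 6) → Bool | ∀ i, x i = true → i ∈ T}, (u x / 8) + 40 -
        2 * ∑ x ∈ {x : Fin (6 + 6) → Bool | ∀ i, x i = true → i ∈ T}, t x := by
    linarith [hsumT]
  generalize ∑ x ∈ {x : Fin (6 + 6) → Bool | ∀ i, x i = true → i ∈ T}, u x = A at e1 e3
  generalize ∑ x ∈ {x : Fin (6 + 6) → Bool | ∀ i, x i = true → i ∈ T}, (u x / 8) = Q at e3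
  generalize ∑ x ∈ {x : Fin (6 + 6) → Bool | ∀ i, x i = true → i ∈ T}, t x = B at e2 e3
  omega

/-- **Type-O capacity on `12` bits is at most `15/16`.** For cubic `g` on `12` bits with all `W_g/16` odd,
`Σ_x |W_g(x)| ≤ 2^{18} · 15/16` (`typeO_capacity` + `no_caseA`; `typeO_capacity` alone gave `1963/2048`). -/
theorem typeO_capacity_15_16 (hg : IsDegLeFun 3 g)
    (hu : ∀ x, W (fun y => signOf (g y)) x = (2 : ℝ) ^ 4 * (u x : ℝ)) (hodd : ∀ x, Odd (u x)) :
    ∑ x, |W (fun y => signOf (g y)) x| ≤ (2 : ℝ) ^ (3 * 6) * (15 / 16) := by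
  refine (typeO_capacity g u hg hu hodd).2 ?_
  by_contra hnone
  push Not at hnone
  exact no_caseA g u hg hu fun x => by
    have h1 := Int.odd_iff.1 (hodd x)
    have h2 := hnone x
    omega

end NoCaseA

/-- **Isolation at `15/16` on `12` bits.** For all cubic `f, g : 𝔽₂¹² → 𝔽₂`: `Φ(f,g) > 15/16 ⇒ Φ(f,g) = 1`
(`window_forces_caseA` + `no_caseA`; the landed constants were `31/32` (`isolation_twelve`) and `1963/2048`
(`isolation_twelve_1963`)). The largest known value below `1` at `n = 12` is `57/64` (`F8ChainTwelve`). -/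
theorem isolation_twelve_15_16 :
    ∀ f g : (Fin (6 + 6) → Bool) → Bool, IsDegLeFun 3 f → IsDegLeFun 3 g →
      15 / 16 < forrelation f g → forrelation f g = 1 := by
  intro f g hf hg hΦ
  by_contra hne
  obtain ⟨u, hu, h35⟩ := window_forces_caseA f g hf hg hΦ hne
  exact no_caseA g u hg hu h35

/-- **No cubic pair on `12` bits has `Φ ∈ (15/16, 1)`.** -/
theorem no_window_twelve_15_16 :
    ¬ ∃ f g : (Fin (6 + 6) → Bool) → Bool, IsDegLeFun 3 f ∧ IsDegLeFun 3 g ∧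
      15 / 16 < forrelation f g ∧ forrelation f g < 1 := by
  rintro ⟨f, g, hf, hg, hlo, hhi⟩
  exact absurd (isolation_twelve_15_16 f g hf hg hlo) (ne_of_lt hhi)

/-- The `n = 12` slice of `NearExactIsExact` with any `θ < 15/16` fails only through values `≤ 15/16`; equivalently,
restricted to `12` bits the crux HOLDS with `θ = 15/16` (and fails with every `θ < 57/64`, `F8ChainTwelve`). -/
theorem nearExact_slice_twelve_15_16 :
    ∀ f g : (Fin (6 + 6) → Bool) → Bool, IsDegLeFun 3 f → IsDegLeFun 3 g →
      forrelation f g ≠ 1 → forrelation f g ≤ 15 / 16 := by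
  intro f g hf hg hne
  by_contra hlt
  push Not at hlt
  exact hne (isolation_twelve_15_16 f g hf hg hlt)

end Summit.QuantumAdvantage.QuantumAdvantage.Theorems.NearExactIsExact.Negative.TypeOTwelve
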